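import Summits.QuantumFields.YangMills.Theorems.OnsetSkewLawRPOnsetFloorPositiveTimeSynthesisCollar
import Summits.QuantumFields.YangMills.Theorems.AtomicSynthesisMomentKilling

/-!
# AtomicSynthesis (stmt-QuantumFields-28126), stub `stub_singleSlot` — H5 (part 1): one round, stages, telescoping

AUTHOR: planner ym-idea-11 g14 (HOME `g14/oneStepSplit.lean` §Iteration/§Telescoping, sorry-free); landed by prover w4 g22
(`--supports 28126`; also path α of 23138 / 22956), split at the 400-line cap.  `OneStep` is VERBATIM the plan's
(`g14/singleSlot-plan.lean`): one round of atomic synthesis at scale ratio `θ`.  This part: the stage/round bookkeeping of the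
iteration `f_{r+1} = f_r − Q_r f_r` (scales `θ^r σ₀`, amplitudes `θ^{5r} A₀`, support radii `≤ ϱ₀ + Rθσ₀/(1−θ)`), telescoping,
uniform convergence of the residuals, geometric mass bounds, and the pointwise sum over rounds (`hasSum_rounds`).
Elementary real analysis; no stub/crux/rung/summit is closed by this file; the YM mass gap is NOT proved. [folklore]
-/

set_option autoImplicit false

noncomputable section

open scoped BigOperators Topology ContDiff
open MeasureTheory Filter Metric
open Summit.QuantumFields.YangMills.Theorems.RPOnsetFloorPosTimeSynthCollar (SlotSynth)

namespace Summit.QuantumFields.YangMills.Cruxes.AtomicSynthesis.SingleSlotPlan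

/-- H4 target (verbatim the plan's `OneStep`). -/
def OneStep (b : SchwartzMap E4 ℝ) (N : ℕ) (θ C R : ℝ) : Prop :=
  ∀ (f : E4 → ℝ) (c : E4) (ϱ σ A : ℝ), ContDiff ℝ ∞ f → 0 < σ → σ ≤ ϱ → 0 ≤ A →
    tsupport f ⊆ closedBall c ϱ →
    (∀ m : ℕ, m ≤ N → ∀ z, ‖iteratedFDeriv ℝ m f z‖ ≤ A / σ ^ m) →
    ∃ (J : ℕ) (a : Fin J → ℝ) (η : Fin J → E4),
      (∀ j, ‖η j - c‖ ≤ ϱ + R * (θ * σ)) ∧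
      (∑ j, |a j| ≤ C * (ϱ / (θ * σ)) ^ 4 * A) ∧
      ContDiff ℝ ∞ (fun z => f z - ∑ j, a j * b ((θ * σ)⁻¹ • (z - η j))) ∧
      tsupport (fun z => f z - ∑ j, a j * b ((θ * σ)⁻¹ • (z - η j))) ⊆ closedBall c (ϱ + R * (θ * σ)) ∧
      ∀ m : ℕ, m ≤ N → ∀ z,
        ‖iteratedFDeriv ℝ m (fun z => f z - ∑ j, a j * b ((θ * σ)⁻¹ • (z - η j))) z‖ ≤ θ ^ 5 * A / (θ * σ) ^ m

section Iteration

variable {b : SchwartzMap E4 ℝ} {N : ℕ} {θ C R : ℝ}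

/-- A stage of the iteration: a smooth residual with its support radius, scale and amplitude. -/
structure Stage (N : ℕ) (c : E4) where
  f : E4 → ℝ
  ϱ : ℝ
  σ : ℝ
  A : ℝ
  hf : ContDiff ℝ ∞ f
  hσ : 0 < σ
  hσϱ : σ ≤ ϱ
  hA : 0 ≤ A
  hsupp : tsupport f ⊆ closedBall c ϱ
  hbd : ∀ m : ℕ, m ≤ N → ∀ z, ‖iteratedFDeriv ℝ m f z‖ ≤ A / σ ^ m

variable {c : E4}

/-- The atoms produced by one round applied to a stage (chosen by `Classical.choose`). -/
structure Round (b : SchwartzMap E4 ℝ) (N : ℕ) (θ C R : ℝ) (c : E4) (S : Stage N c) where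
  J : ℕ
  a : Fin J → ℝ
  η : Fin J → E4
  hη : ∀ j, ‖η j - c‖ ≤ S.ϱ + R * (θ * S.σ)
  hmass : ∑ j, |a j| ≤ C * (S.ϱ / (θ * S.σ)) ^ 4 * S.A
  hf' : ContDiff ℝ ∞ (fun z => S.f z - ∑ j, a j * b ((θ * S.σ)⁻¹ • (z - η j)))
  hsupp' : tsupport (fun z => S.f z - ∑ j, a j * b ((θ * S.σ)⁻¹ • (z - η j))) ⊆ closedBall c (S.ϱ + R * (θ * S.σ))
  hbd' : ∀ m : ℕ, m ≤ N → ∀ z,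
    ‖iteratedFDeriv ℝ m (fun z => S.f z - ∑ j, a j * b ((θ * S.σ)⁻¹ • (z - η j))) z‖ ≤ θ ^ 5 * S.A / (θ * S.σ) ^ m

/-- One round exists at every stage. -/
theorem nonempty_round (h : OneStep b N θ C R) (S : Stage N c) : Nonempty (Round b N θ C R c S) := by
  obtain ⟨J, a, η, h1, h2, h3, h4, h5⟩ := h S.f c S.ϱ S.σ S.A S.hf S.hσ S.hσϱ S.hA S.hsupp S.hbd
  exact ⟨⟨J, a, η, h1, h2, h3, h4, h5⟩⟩

/-- The chosen round. -/
def round (h : OneStep b N θ C R) (S : Stage N c) : Round b N θ C R c S :=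
  Classical.choice (nonempty_round h S)

/-- The next stage. -/
def next (h : OneStep b N θ C R) (hθ : 0 < θ) (hθ1 : θ ≤ 1) (hR : 0 ≤ R) (S : Stage N c) : Stage N c where
  f := fun z => S.f z - ∑ j, (round h S).a j * b ((θ * S.σ)⁻¹ • (z - (round h S).η j))
  ϱ := S.ϱ + R * (θ * S.σ)
  σ := θ * S.σ
  A := θ ^ 5 * S.A
  hf := (round h S).hf'
  hσ := mul_pos hθ S.hσ
  hσϱ := by
    have h1 : θ * S.σ ≤ S.σ := by nlinarith [S.hσ]
    have h2 : 0 ≤ R * (θ * S.σ) := mul_nonneg hR (mul_nonneg hθ.le S.hσ.le)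
    linarith [S.hσϱ]
  hA := mul_nonneg (pow_nonneg hθ.le 5) S.hA
  hsupp := (round h S).hsupp'
  hbd := (round h S).hbd'

/-- The initial stage: `ψ` itself at scale `s ρ`. -/
def stage₀ (ψ : SchwartzMap E4 ℝ) (c : E4) (ρ M' s : ℝ) (hρ : 0 < ρ) (hs : 0 < s) (hs1 : s ≤ 1)
    (hsupp : tsupport ψ ⊆ closedBall c (3 / 2 * ρ))
    (hbd : ∀ m : ℕ, m ≤ N → ∀ z, ‖iteratedFDeriv ℝ m ψ z‖ ≤ M' / ρ ^ m) : Stage N c where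
  f := ψ
  ϱ := 3 / 2 * ρ
  σ := s * ρ
  A := M'
  hf := ψ.smooth ⊤
  hσ := mul_pos hs hρ
  hσϱ := by nlinarith
  hA := by
    have := hbd 0 (Nat.zero_le _) c
    simp only [pow_zero, div_one] at this
    exact (norm_nonneg _).trans this
  hsupp := hsupp
  hbd := by
    intro m hm z
    have hM' : 0 ≤ M' := by
      have := hbd 0 (Nat.zero_le _) c
      simp only [pow_zero, div_one] at this
      exact (norm_nonneg _).trans this
    refine (hbd m hm z).trans ?_
    apply div_le_div_of_nonneg_left hM' (pow_pos (mul_pos hs hρ) m)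
    exact pow_le_pow_left₀ (mul_pos hs hρ).le (by nlinarith) m

/-- The `r`-th stage. -/
def stage (h : OneStep b N θ C R) (hθ : 0 < θ) (hθ1 : θ ≤ 1) (hR : 0 ≤ R) (S₀ : Stage N c) : ℕ → Stage N c
  | 0 => S₀
  | r + 1 => next h hθ hθ1 hR (stage h hθ hθ1 hR S₀ r)

/-- The scale after `r` rounds is `θ^r σ₀`. -/
theorem stage_σ (h : OneStep b N θ C R) (hθ : 0 < θ) (hθ1 : θ ≤ 1) (hR : 0 ≤ R) (S₀ : Stage N c) (r : ℕ) :
    (stage h hθ hθ1 hR S₀ r).σ = θ ^ r * S₀.σ := by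
  induction r with
  | zero => simp [stage]
  | succ r ih => simp [stage, next, ih, pow_succ]; ring

/-- The amplitude after `r` rounds is `θ^{5r} A₀`. -/
theorem stage_A (h : OneStep b N θ C R) (hθ : 0 < θ) (hθ1 : θ ≤ 1) (hR : 0 ≤ R) (S₀ : Stage N c) (r : ℕ) :
    (stage h hθ hθ1 hR S₀ r).A = θ ^ (5 * r) * S₀.A := by
  induction r with
  | zero => simp [stage]
  | succ r ih => simp [stage, next, ih]; ring

/-- The support-radius invariant: `ϱ_r + R θ σ_r/(1−θ)` is constant. -/
theorem stage_ϱ_inv (h : OneStep b N θ C R) (hθ : 0 < θ) (hθ1 : θ < 1) (hR : 0 ≤ R) (S₀ : Stage N c) (r : ℕ) :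
    (stage h hθ hθ1.le hR S₀ r).ϱ + R * θ * (stage h hθ hθ1.le hR S₀ r).σ / (1 - θ) =
      S₀.ϱ + R * θ * S₀.σ / (1 - θ) := by
  induction r with
  | zero => simp [stage]
  | succ r ih =>
    rw [← ih]
    simp only [stage, next]
    have h1 : (1 - θ) ≠ 0 := by linarith
    field_simp
    ring

/-- The support radius never exceeds `ϱ₀ + R θ σ₀/(1−θ)`. -/
theorem stage_ϱ_le (h : OneStep b N θ C R) (hθ : 0 < θ) (hθ1 : θ < 1) (hR : 0 ≤ R) (S₀ : Stage N c) (r : ℕ) :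
    (stage h hθ hθ1.le hR S₀ r).ϱ + R * (θ * (stage h hθ hθ1.le hR S₀ r).σ) ≤ S₀.ϱ + R * θ * S₀.σ / (1 - θ) := by
  have hinv := stage_ϱ_inv h hθ hθ1 hR S₀ r
  set S := stage h hθ hθ1.le hR S₀ r
  have h1 : 0 < 1 - θ := by linarith
  have hx : 0 ≤ R * θ * S.σ := mul_nonneg (mul_nonneg hR hθ.le) S.hσ.le
  have : R * (θ * S.σ) ≤ R * θ * S.σ / (1 - θ) := by
    rw [le_div_iff₀ h1]; nlinarith
  linarith

end Iteration


section Telescoping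

variable {b : SchwartzMap E4 ℝ} {N : ℕ} {θ C R : ℝ} {c : E4}
variable (h : OneStep b N θ C R) (hθ : 0 < θ) (hθ1 : θ < 1) (hR : 0 ≤ R) (S₀ : Stage N c)

/-- The atoms of round `r`. -/
def atom (r : ℕ) (j : Fin (round h (stage h hθ hθ1.le hR S₀ r)).J) (z : E4) : ℝ :=
  (round h (stage h hθ hθ1.le hR S₀ r)).a j *
    b ((θ * (stage h hθ hθ1.le hR S₀ r).σ)⁻¹ • (z - (round h (stage h hθ hθ1.le hR S₀ r)).η j))

/-- The residual after round `r+1` is the residual after round `r` minus the atoms of round `r`. -/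
theorem stage_succ_f (r : ℕ) (z : E4) :
    (stage h hθ hθ1.le hR S₀ (r + 1)).f z = (stage h hθ hθ1.le hR S₀ r).f z - ∑ j, atom h hθ hθ1 hR S₀ r j z := by
  simp [stage, next, atom]

/-- Telescoping: `ψ − f_n = Σ_{r<n} Σ_j atom_{r,j}`. -/
theorem telescope (n : ℕ) (z : E4) :
    S₀.f z - (stage h hθ hθ1.le hR S₀ n).f z = ∑ r ∈ Finset.range n, ∑ j, atom h hθ hθ1 hR S₀ r j z := by
  induction n with
  | zero => simp [stage]
  | succ n ih => rw [Finset.sum_range_succ, ← ih, stage_succ_f h hθ hθ1 hR S₀ n z]; ring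

/-- The residual is bounded by its amplitude: `|f_n z| ≤ θ^{5n} A₀`. -/
theorem abs_stage_f_le (n : ℕ) (z : E4) : |(stage h hθ hθ1.le hR S₀ n).f z| ≤ θ ^ (5 * n) * S₀.A := by
  have := (stage h hθ hθ1.le hR S₀ n).hbd 0 (Nat.zero_le _) z
  rw [norm_iteratedFDeriv_zero, pow_zero, div_one, stage_A] at this
  simpa [Real.norm_eq_abs] using this

/-- The residual tends to zero pointwise. -/
theorem tendsto_stage_f (z : E4) : Tendsto (fun n => (stage h hθ hθ1.le hR S₀ n).f z) atTop (𝓝 0) := by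
  have hg : Tendsto (fun n : ℕ => θ ^ (5 * n) * S₀.A) atTop (𝓝 0) := by
    have h1 : Tendsto (fun n : ℕ => (θ ^ 5) ^ n) atTop (𝓝 0) :=
      tendsto_pow_atTop_nhds_zero_of_lt_one (pow_nonneg hθ.le 5) (pow_lt_one₀ hθ.le hθ1 (by norm_num))
    have := h1.mul_const S₀.A
    simpa [← pow_mul, zero_mul] using this
  exact squeeze_zero_norm (fun n => by simpa [Real.norm_eq_abs] using abs_stage_f_le h hθ hθ1 hR S₀ n z) hg

/-- Mass of round `r`: `Σ_j |a_{r,j}| ≤ C (ϱ_r/(θσ_r))⁴ A_r`, and `ϱ_r ≤ P := ϱ₀ + Rθσ₀/(1−θ)`. -/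
theorem mass_le (r : ℕ) (hC : 0 ≤ C) :
    ∑ j, |(round h (stage h hθ hθ1.le hR S₀ r)).a j| ≤
      C * ((S₀.ϱ + R * θ * S₀.σ / (1 - θ)) / (θ ^ (r + 1) * S₀.σ)) ^ 4 * (θ ^ (5 * r) * S₀.A) := by
  set S := stage h hθ hθ1.le hR S₀ r with hS
  have hm := (round h S).hmass
  have hϱ : S.ϱ ≤ S₀.ϱ + R * θ * S₀.σ / (1 - θ) := by
    have := stage_ϱ_le h hθ hθ1 hR S₀ r
    have hx : 0 ≤ R * (θ * S.σ) := mul_nonneg hR (mul_nonneg hθ.le S.hσ.le)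
    rw [← hS] at this; linarith
  have hσ : θ * S.σ = θ ^ (r + 1) * S₀.σ := by rw [hS, stage_σ]; ring
  have hA : S.A = θ ^ (5 * r) * S₀.A := by rw [hS, stage_A]
  rw [hσ] at hm; rw [hA] at hm
  refine hm.trans ?_
  have hpos : 0 < θ ^ (r + 1) * S₀.σ := mul_pos (pow_pos hθ _) S₀.hσ
  have hϱ0 : 0 ≤ S.ϱ := S.hσ.le.trans S.hσϱ
  gcongr
  · exact mul_nonneg (pow_nonneg hθ.le _) S₀.hA

/-- Pointwise: the atom series over rounds sums to `ψ z` (absolutely, by the mass bounds). -/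
theorem hasSum_rounds (hC : 0 ≤ C) (z : E4) :
    HasSum (fun r => ∑ j, atom h hθ hθ1 hR S₀ r j z) (S₀.f z) := by
  -- sup bound on `b`
  obtain ⟨B, hBpos, hB⟩ := b.decay 0 0
  have hB' : ∀ x, |b x| ≤ B := fun x => by simpa [norm_iteratedFDeriv_zero, Real.norm_eq_abs] using hB x
  have hB0 : 0 ≤ B := hBpos.le
  -- geometric majorant
  set P := S₀.ϱ + R * θ * S₀.σ / (1 - θ) with hP
  set K := C * (P / (θ * S₀.σ)) ^ 4 * S₀.A * B with hK
  have hmaj : ∀ r, ‖∑ j, atom h hθ hθ1 hR S₀ r j z‖ ≤ K * θ ^ r := by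
    intro r
    rw [Real.norm_eq_abs]
    refine (Finset.abs_sum_le_sum_abs _ _).trans ?_
    have h1 : ∑ j, |atom h hθ hθ1 hR S₀ r j z| ≤ (∑ j, |(round h (stage h hθ hθ1.le hR S₀ r)).a j|) * B := by
      rw [Finset.sum_mul]
      refine Finset.sum_le_sum fun j _ => ?_
      rw [atom, abs_mul]
      exact mul_le_mul_of_nonneg_left (hB' _) (abs_nonneg _)
    refine h1.trans ?_
    have h2 := mass_le h hθ hθ1 hR S₀ r hC
    rw [← hP] at h2
    have h3 : C * (P / (θ ^ (r + 1) * S₀.σ)) ^ 4 * (θ ^ (5 * r) * S₀.A) = (C * (P / (θ * S₀.σ)) ^ 4 * S₀.A) * θ ^ r := by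
      have hθ0 : θ ≠ 0 := hθ.ne'
      have hσ0 : S₀.σ ≠ 0 := S₀.hσ.ne'
      field_simp
      ring
    rw [h3] at h2
    calc (∑ j, |(round h (stage h hθ hθ1.le hR S₀ r)).a j|) * B
        ≤ (C * (P / (θ * S₀.σ)) ^ 4 * S₀.A * θ ^ r) * B := mul_le_mul_of_nonneg_right h2 hB0
      _ = K * θ ^ r := by rw [hK]; ring
  have hsum : Summable (fun r => ∑ j, atom h hθ hθ1 hR S₀ r j z) :=
    Summable.of_norm_bounded (g := fun r => K * θ ^ r) ((summable_geometric_of_lt_one hθ.le hθ1).mul_left K) hmaj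
  rw [hsum.hasSum_iff_tendsto_nat]
  have ht : Tendsto (fun n => S₀.f z - (stage h hθ hθ1.le hR S₀ n).f z) atTop (𝓝 (S₀.f z - 0)) :=
    tendsto_const_nhds.sub (tendsto_stage_f h hθ hθ1 hR S₀ z)
  rw [sub_zero] at ht
  refine ht.congr fun n => ?_
  rw [telescope]

end Telescoping

end Summit.QuantumFields.YangMills.Cruxes.AtomicSynthesis.SingleSlotPlan

end
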